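import Mathlib
import HarnessLib
import Literature.Probability.MarkovChains.RelaxationTime
import Literature.Probability.MarkovChains.ISIRUniformErgodicity

/-!
# A kernel minorised by its stationary law, `P(x, ·) ≥ ε π(·)`, has every eigenvalue `λ ≠ 1` in the
# disc `|λ| ≤ 1 − ε`: absolute spectral gap `≥ ε`, relaxation time `≤ 1/ε` — for i-SIR,
# `t_rel ≤ (2W + n)/(n + 1)` (finite state spaces)

[cite: AndrieuLeeVihola2018, §3 Theorem 1 (second display: for every `ν ≪ π`,
`‖ν P_Nᵏ − π‖_{L²(X,π)} ≤ ‖ν − π‖_{L²(X,π)} (1 − ε_N)ᵏ` under the minorisation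
`P_N(x, S) ≥ ε_N π(S)`), §4 ("the minorization constant `ε_N = (N−1)/(2Ḡ+N−2)` provides the upper
bound `1 − ε_N` on the (geometric) rate of convergence of the algorithm")]

On a finite state space the geometric `L²(π)` bound of the cited theorem says that `P_N − Π` has
operator norm `≤ 1 − ε_N` on `L²₀(π)`; this file types its spectral consequence directly and for
any stochastic matrix: if `π` is stationary for `P` (`Σ π = 1`) and `P(x, y) ≥ ε π(y)` for all
`x, y`, then every eigenvalue `λ ≠ 1` of `P` satisfies `|λ| ≤ 1 − ε` — an eigenvector `f` of such
a `λ` has `Σ π f = 0` (stationarity), so `λ f = (P − εΠ) f` with `P − εΠ` entrywise non-negative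
of row sums `1 − ε`, and the maximum-modulus argument of Levin–Peres Lemma 12.1 gives the bound.
Hence `λ⋆ ≤ 1 − ε`, `γ⋆ ≥ ε`, `t_rel ≤ 1/ε` (vocabulary of `RelaxationTime.lean`).

## Content

* (`RelaxationTimeLowerBound.sum_mul_eigenfunction_eq_zero` — `πP = π`, `Pf = λf`, `λ ≠ 1` ⟹
  `Σ π f = 0` — is reused.)
* **`norm_eigenvalue_le_of_minorized`** — `|λ| ≤ 1 − ε` for every eigenvalue `λ ≠ 1`.
* `lambdaStar_le_of_minorized`, `absSpectralGap_ge_of_minorized`, `relaxationTime_le_of_minorized`.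
* **`isir_lambdaStar_le`**, **`isir_relaxationTime_le`** — for i-SIR with `n + 1` fresh proposals
  and weights `≤ W`: `λ⋆ ≤ 1 − (n+1)/(2W+n)` and `t_rel ≤ (2W+n)/(n+1)`
  (`ISIRUniformErgodicity.isirKernel_minorized`).

NOT CLAIMED: the `L²(π)` operator-norm statement itself for non-reversible `P`; general state
spaces.
-/

namespace Literature.Probability.MarkovChains

open Finset

variable {X : Type*} [Fintype X] [DecidableEq X]

omit [DecidableEq X] in
/-- **Eigenvalues of a minorised chain**: if `P` is stochastic with stationary probability vector
`π` and `P(x, y) ≥ ε π(y)` for all `x, y`, then every eigenvalue `λ ≠ 1` of `P` (with eigenvector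
`f`) satisfies `|λ| ≤ 1 − ε`: `λ f(x) = Σ_y (P(x,y) − ε π(y)) f(y)` since `Σ π f = 0`, and the
kernel `P − εΠ` is non-negative with row sums `1 − ε`. [cite: AndrieuLeeVihola2018, §3 Theorem 1
(second display, the `L²(π)` rate `(1 − ε_N)ᵏ`), §4]; the maximum-modulus step is that of
[cite: LevinPeres2017, §12.1 Lemma 12.1 (i)]. -/
theorem norm_eigenvalue_le_of_minorized {P : X → X → ℝ} (hP : IsRowStochastic P) {π : X → ℝ}
    (hst : IsStationary π P) (hπ1 : ∑ x, π x = 1) {ε : ℝ} (hmin : ∀ x y, ε * π y ≤ P x y)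
    {f : X → ℂ} {lam : ℂ} (hf : ∀ x, ∑ y, (P x y : ℂ) * f y = lam * f x) (hf0 : f ≠ 0)
    (hlam : lam ≠ 1) : ‖lam‖ ≤ 1 - ε := by
  have hs := sum_mul_eigenfunction_eq_zero hst hf hlam
  -- `λ f(x) = Σ_y (P(x,y) − ε π(y)) f(y)`
  have hR : ∀ x, ∑ y, ((P x y - ε * π y : ℝ) : ℂ) * f y = lam * f x := by
    intro x
    rw [← hf x]
    simp_rw [Complex.ofReal_sub, Complex.ofReal_mul, sub_mul]
    rw [sum_sub_distrib, sub_eq_self]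
    calc ∑ y, (ε : ℂ) * (π y : ℂ) * f y = (ε : ℂ) * ∑ y, (π y : ℂ) * f y := by
          rw [mul_sum]; exact sum_congr rfl fun y _ => by ring
      _ = 0 := by rw [hs, mul_zero]
  obtain ⟨x₁, hx₁⟩ : ∃ x, f x ≠ 0 := Function.ne_iff.mp hf0
  obtain ⟨x, -, hx⟩ := exists_max_image univ (fun x => ‖f x‖) ⟨x₁, mem_univ _⟩
  have hfx : 0 < ‖f x‖ := (norm_pos_iff.mpr hx₁).trans_le (hx x₁ (mem_univ _))
  have hRnn : ∀ y, 0 ≤ P x y - ε * π y := fun y => sub_nonneg.2 (hmin x y)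
  have h1 : ‖lam‖ * ‖f x‖ ≤ (1 - ε) * ‖f x‖ := by
    calc ‖lam‖ * ‖f x‖ = ‖∑ y, ((P x y - ε * π y : ℝ) : ℂ) * f y‖ := by rw [← norm_mul, ← hR x]
      _ ≤ ∑ y, ‖((P x y - ε * π y : ℝ) : ℂ) * f y‖ := norm_sum_le _ _
      _ = ∑ y, (P x y - ε * π y) * ‖f y‖ := sum_congr rfl fun y _ => by
          rw [norm_mul, Complex.norm_real, Real.norm_of_nonneg (hRnn y)]
      _ ≤ ∑ y, (P x y - ε * π y) * ‖f x‖ :=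
          sum_le_sum fun y _ => mul_le_mul_of_nonneg_left (hx y (mem_univ _)) (hRnn y)
      _ = (1 - ε) * ‖f x‖ := by
          rw [← sum_mul, sum_sub_distrib, hP.2 x, ← mul_sum, hπ1, mul_one]
  exact le_of_mul_le_mul_right h1 hfx

/-- `λ⋆ ≤ 1 − ε` under the minorisation `P ≥ ε π` (`π` stationary).
[cite: AndrieuLeeVihola2018, §3 Theorem 1 (second display), §4 ("`1 − ε_N` … the (geometric)
rate of convergence")]; `λ⋆` of [cite: LevinPeres2017, §12.2 eq. (12.6)] -/
theorem lambdaStar_le_of_minorized {P : X → X → ℝ} (hP : IsRowStochastic P) {π : X → ℝ}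
    (hst : IsStationary π P) (hπ1 : ∑ x, π x = 1) {ε : ℝ}
    (hmin : ∀ x y, ε * π y ≤ P x y) : lambdaStar P ≤ 1 - ε := by
  by_cases h : (nontrivialEigenvalues P).Nonempty
  · obtain ⟨μ, hμ, hμeq⟩ := exists_norm_eq_lambdaStar h
    obtain ⟨f, hf⟩ := hμ.1.exists_hasEigenvector
    obtain ⟨hf0, hfx⟩ := (hasEigenvector_iff P f μ).mp hf
    rw [← hμeq]
    exact norm_eigenvalue_le_of_minorized hP hst hπ1 hmin hfx hf0 hμ.2
  · obtain ⟨x₀⟩ : Nonempty X := by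
      rw [← not_isEmpty_iff]
      intro hX
      rw [Finset.univ_eq_empty, Finset.sum_empty] at hπ1
      exact zero_ne_one hπ1
    have hε1 : ε ≤ 1 := by
      have h2 := sum_le_sum fun y (_ : y ∈ univ) => hmin x₀ y
      rwa [← mul_sum, hπ1, mul_one, hP.2 x₀] at h2
    unfold lambdaStar
    rw [Set.not_nonempty_iff_eq_empty.mp h, Set.image_empty, Real.sSup_empty]
    linarith

/-- `γ⋆ ≥ ε` under the minorisation. [cite: AndrieuLeeVihola2018, §3 Theorem 1, §4];
`γ⋆` of [cite: LevinPeres2017, §12.2] -/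
theorem absSpectralGap_ge_of_minorized {P : X → X → ℝ} (hP : IsRowStochastic P) {π : X → ℝ}
    (hst : IsStationary π P) (hπ1 : ∑ x, π x = 1) {ε : ℝ}
    (hmin : ∀ x y, ε * π y ≤ P x y) : ε ≤ absSpectralGap P := by
  unfold absSpectralGap
  linarith [lambdaStar_le_of_minorized hP hst hπ1 hmin]

/-- `t_rel ≤ 1/ε` under the minorisation (`ε > 0`). [cite: AndrieuLeeVihola2018, §3 Theorem 1,
§4]; `t_rel` of [cite: LevinPeres2017, §12.2] -/
theorem relaxationTime_le_of_minorized {P : X → X → ℝ} (hP : IsRowStochastic P) {π : X → ℝ}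
    (hst : IsStationary π P) (hπ1 : ∑ x, π x = 1) {ε : ℝ} (hε : 0 < ε)
    (hmin : ∀ x y, ε * π y ≤ P x y) : relaxationTime P ≤ 1 / ε := by
  unfold relaxationTime
  exact one_div_le_one_div_of_le hε (absSpectralGap_ge_of_minorized hP hst hπ1 hmin)

/-! ## i-SIR -/

section ISIR

variable {p q : X → ℝ} {W : ℝ}

/-- **i-SIR: every eigenvalue `λ ≠ 1` has `|λ| ≤ 1 − ε_N`**, `ε_N = (n+1)/(2W+n)` (`n + 1` fresh
proposals, weights `p ≤ W q`): `λ⋆(P_N) ≤ 1 − (n+1)/(2W+n)`.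
[cite: AndrieuLeeVihola2018, §3 Theorem 1 (second display) with §4 (`ε_N = (N−1)/(2Ḡ+N−2)`)] -/
theorem isir_lambdaStar_le (hp : ∀ x, 0 < p x) (hp1 : ∑ x, p x = 1) (hq : ∀ x, 0 < q x)
    (hq1 : ∑ x, q x = 1) (n : ℕ) (hW : ∀ x, p x ≤ W * q x) :
    lambdaStar (isirKernel q p (n + 1)) ≤ 1 - (n + 1) / (2 * W + n) := by
  obtain ⟨x₀⟩ : Nonempty X := by
    rw [← not_isEmpty_iff]
    intro hX
    rw [Finset.univ_eq_empty, Finset.sum_empty] at hp1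
    exact zero_ne_one hp1
  have hW0 : 0 < W := pos_of_mul_pos_left ((hp x₀).trans_le (hW x₀)) (hq x₀).le
  exact lambdaStar_le_of_minorized (isirKernel_isRowStochastic hp hq hq1 (n + 1))
    (isirKernel_isStationary hp hq hq1 (n + 1)) hp1
    (fun x y => isirKernel_minorized hp hp1 hq hq1 n hW x y)

/-- **i-SIR: relaxation time `t_rel(P_N) ≤ 1/ε_N = (2W + n)/(n + 1)`** — `n + 1` fresh proposals
per update bring the relaxation time of the independence chain down to at most
`(2W + n)/(n + 1)` (compare `IndependenceSamplerSpectrum.imh_relaxationTime_eq`: `t_rel = W` for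
the one-proposal Metropolized independence sampler). [cite: AndrieuLeeVihola2018, §3 Theorem 1
(second display), §4]; `t_rel` of [cite: LevinPeres2017, §12.2] -/
theorem isir_relaxationTime_le (hp : ∀ x, 0 < p x) (hp1 : ∑ x, p x = 1) (hq : ∀ x, 0 < q x)
    (hq1 : ∑ x, q x = 1) (n : ℕ) (hW : ∀ x, p x ≤ W * q x) :
    relaxationTime (isirKernel q p (n + 1)) ≤ (2 * W + n) / (n + 1) := by
  obtain ⟨x₀⟩ : Nonempty X := by
    rw [← not_isEmpty_iff]
    intro hX
    rw [Finset.univ_eq_empty, Finset.sum_empty] at hp1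
    exact zero_ne_one hp1
  have hW0 : 0 < W := pos_of_mul_pos_left ((hp x₀).trans_le (hW x₀)) (hq x₀).le
  have h := relaxationTime_le_of_minorized (isirKernel_isRowStochastic hp hq hq1 (n + 1))
    (isirKernel_isStationary hp hq hq1 (n + 1)) hp1 (by positivity : (0 : ℝ) < (n + 1) / (2 * W + n))
    (fun x y => isirKernel_minorized hp hp1 hq hq1 n hW x y)
  rwa [one_div_div] at h

end ISIR

end Literature.Probability.MarkovChains
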